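import Literature.AlgebraicGeometry.FundamentalGroup.RiemannExistenceZariskiLocal
import Literature.AlgebraicGeometry.FundamentalGroup.RiemannExistenceEtaleLocalHomeomorph
import Mathlib.RingTheory.Etale.StandardEtale
import Mathlib.RingTheory.Polynomial.Resultant.Basic
import Mathlib.FieldTheory.IsAlgClosed.Basic
import HarnessLib

/-!
# Riemann's existence theorem: a finite covering with regular characteristic polynomials is algebraic

Topic `Literature/AlgebraicGeometry/FundamentalGroup`; proof file attached to the named fact
`riemannExistence_finiteCovering` (`RiemannExistenceCovering.lean`, SGA1 Exp. XII Thm. 5.1,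
essential surjectivity of `X' ↦ X'^an` on finite étale covers) and, through
`RiemannExistenceQbarDescentProofs.lean`, to `riemannExistence_qbarDescent_of_finiteIndex`.
It proves the ALGEBRAISATION STEP common to every function-theoretic proof of Riemann's existence
theorem (Riemann, Grauert–Remmert, Hörmander's `L²` method, Serre's GAGA via n° 16 Lemme 8): once
the sheets of a finite covering `q : T → X(ℂ)` are separated by (continuous) functions `h` on `T`
which are ALGEBRAIC over the regular functions of `X` — precisely: whose characteristic polynomial
along the fibres `χ_h(P)(τ) = ∏_{t ∈ q⁻¹(P)} (τ - h t)` has REGULAR coefficients — the covering is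
the set of complex points of a finite étale `X`-scheme.

* `CharPoly.exists_finite_etale_homeomorph_of_charPoly` — **Theorem.** Let `X` be separated and
  locally of finite type over `ℂ`, `q : T → X(ℂ)` a local homeomorphism with finite fibres (e.g. a
  covering map with finite fibres), and suppose that every complex point `P₀` has an affine open
  neighbourhood `U ⊆ X` together with `h : T → ℂ`, continuous on `q⁻¹(U(ℂ))`, and a MONIC
  `Q ∈ Γ(X, U)[τ]` such that for every `P ∈ U(ℂ)` the roots of `Q(P) ∈ ℂ[τ]`, with multiplicity,
  are the values of `h` on the fibre `q⁻¹(P)`, and `h` is injective on `q⁻¹(P₀)`. Then there are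
  a finite étale `g : Y ⟶ X` and a homeomorphism `Y(ℂ) ≃ₜ T` over `X(ℂ)`
  (`…_of_isCoveringMap`: the same for a covering map `q`, the shape of the tree's Riemann-existence
  statements `riemannExistence_finiteCovering`, `ZariskiLocal.riemannExistence_of_affineOpens`).

Proof (Dedekind–Kummer: «`A[τ]/(Q)` is étale where the discriminant is invertible», and the
Zariski-localness of essential surjectivity, SGA1 XII 5.1 proof, part 2, the tree's
`ZariskiLocal.exists_finite_etale_homeomorph_of_locally`, `RiemannExistenceZariskiLocal.lean`):

1. (`CharPoly.pair`, `CharPoly.presentation`) For a monic `Q ∈ A[τ]` let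
   `δ = Res(Q, Q') ∈ A` (Mathlib `Polynomial.resultant`, Bézout identity
   `Q' p + Q q = δ`, `Polynomial.exists_mul_add_mul_eq_C_resultant`). If `δ` is a unit of `A`
   then `A[τ]/(Q) = AdjoinRoot Q` is a STANDARD ÉTALE `A`-algebra (Mathlib `StandardEtalePair`
   `⟨Q, C δ⟩`, presented by the class of `τ`), hence finite étale over `A`
   (`CharPoly.finite_adjoinRoot`, Mathlib `Algebra.IsStandardEtale → Algebra.Etale`).
2. (`CharPoly.Y`, `CharPoly.g`, `CharPoly.toU`) For an affine open `U = Spec A ⊆ X` and such a `Q`,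
   the `X`-scheme `Y = Spec A[τ]/(Q) → U ⊆ X` is finite étale over `U`; its complex points over
   `P ∈ U(ℂ)` are the simple roots of `Q(P)` (the point-set dictionary of a standard-étale chart,
   `eval_map_f_eq_zero`, `eq_of_map_eq_of_eval_x_eq`, and the continuous sections
   `exists_continuous_section` of `RiemannExistenceEtaleLocalHomeomorph.lean`, SGA1 XII 3.1 (iii)).
3. (`CharPoly.localAlgebraization`) If the roots of `Q(P)` are the values of `h` on `q⁻¹(P)` for all
   `P ∈ U(ℂ)` and `δ` is a unit, then `t ↦ (q t, h t)` is a continuous bijection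
   `q⁻¹(U(ℂ)) → Y(ℂ)` over `U(ℂ)` (injective because the roots of `Q(P)` are simple, so `h`
   separates every fibre over `U`), between spaces étalé over `X(ℂ)` (`q`, and `g(ℂ)` by
   `isLocalHomeomorph_map_of_etale`), hence a homeomorphism (Mathlib
   `IsLocalHomeomorph.of_comp`, `IsLocalHomeomorph.toHomeomorphOfBijective`): an algebraisation of
   `q` over `U` in the sense of `ZariskiLocal.LocalAlgebraization`.
4. (the theorem) `h` injective on `q⁻¹(P₀)` means that `Q(P₀)` has simple roots, i.e.
   `δ(P₀) ≠ 0` (`Polynomial.nodup_roots_iff_of_splits`, `Polynomial.isUnit_resultant_iff_isCoprime`),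
   so step 3 applies over the affine open `D(δ) ∋ P₀` (`Γ(X, D(δ)) = A[1/δ]`,
   `IsAffineOpen.isLocalization_basicOpen`); these opens cover all closed points, hence all of `X`
   (`X` is Jacobson, `ComplexPoints.exists_pt_mem`), and the local algebraisations glue
   (`ZariskiLocal.exists_finite_etale_homeomorph_of_locally`).

What is NOT here: the production of such functions `h` — for `q`-holomorphic `h` integral over
`Γ(X, 𝒪_X)` the coefficients of `χ_h` are holomorphic and integral, hence regular (sequel file),
and the EXISTENCE of enough algebraic holomorphic functions on `T` is the transcendental heart of
XII 5.1 (Grauert–Remmert / GAGA / `L²` estimates), not claimed.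

## References

* [SGA1] A. Grothendieck, M. Raynaud, *Revêtements étales et groupe fondamental (SGA 1)*, LNM 224 /
  arXiv:math/0206203: Exp. I Thm. 7.6 (standard étale algebras), Exp. XII Prop. 3.1 (iii),
  Thm. 5.1 (p. 333; proof, part 2: «la question est locale sur `X`»). Read via
  `lit read arxiv:math/0206203` (p0015, p0180, p0184 of the materialised text).
* [StacksProject] The Stacks Project, Tag 00UE (standard étale ring maps `R[x]_g/(f)`, `f' ` a unit)
  and Tag 01LH (relative glueing).
* J.-P. Serre, *Géométrie algébrique et géométrie analytique*, Ann. Inst. Fourier 6 (1956), n° 16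
  Lemme 8, n° 19–20 (the function-theoretic algebraisation pattern). [SerreGAGA1956]

#harness_tags algebraic_geometry.etale, algebraic_geometry.sga1, complex_geometry.riemann_existence
-/

noncomputable section

open CategoryTheory AlgebraicGeometry Polynomial
open _root_.Topology

namespace Literature.AlgebraicGeometry.FundamentalGroup

open Literature.AlgebraicGeometry.Motives Literature.AlgebraicGeometry.Motives.AlgPoints

namespace CharPoly

/-! ### Step 1: `A[τ]/(Q)` is standard étale when `Res(Q, Q')` is a unit -/

section Algebra

variable {A : Type*} [CommRing A] (Q : A[X])

/-- `δ(Q) = Res(Q, Q')`, the resultant of a polynomial and its derivative in the degrees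
`(deg Q, deg Q - 1)` (up to sign and the leading coefficient, the discriminant; Mathlib
`Polynomial.resultant`). [folklore] -/
def resDeriv : A := Q.resultant Q.derivative Q.natDegree (Q.natDegree - 1)

/-- `δ` commutes with ring homomorphisms, for `Q` monic. [folklore] -/
theorem resDeriv_map {B : Type*} [CommRing B] (φ : A →+* B) (hQ : Q.Monic) :
    resDeriv (Q.map φ) = φ (resDeriv Q) := by
  nontriviality B
  unfold resDeriv
  rw [derivative_map, hQ.natDegree_map, resultant_map_map]

/-- **Bézout identity for the resultant**: `Q' p + Q q = δ(Q)` for some `p, q ∈ A[τ]`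
(Mathlib `Polynomial.exists_mul_add_mul_eq_C_resultant`; for `deg Q = 0`, `Q = 1` and `δ = 1`).
[folklore] -/
theorem exists_derivative_mul_add_mul_eq (hQ : Q.Monic) :
    ∃ p q : A[X], derivative Q * p + Q * q = C (resDeriv Q) := by
  by_cases hd : Q.natDegree = 0
  · have h1 : Q = 1 := hQ.natDegree_eq_zero.mp hd
    refine ⟨0, 1, ?_⟩
    have h2 : resDeriv Q = 1 := by
      unfold resDeriv
      rw [hd, Nat.zero_sub, resultant_zero_right_deg, pow_zero]
    rw [h2, h1, derivative_one, mul_zero, zero_add, mul_one, C_1]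
  · obtain ⟨p, q, -, -, e⟩ := exists_mul_add_mul_eq_C_resultant Q (derivative Q)
      (m := Q.natDegree) (n := Q.natDegree - 1) le_rfl (natDegree_derivative_le Q) (Or.inl hd)
    refine ⟨q, p, ?_⟩
    unfold resDeriv
    rw [← e]
    ring

/-- **The standard étale pair `⟨Q, δ(Q)⟩`**: `Q` monic and `Q' p + Q q = δ = (C δ)¹`, so that
`A[τ][y]/(Q, y δ - 1) = (A[τ]/(Q))[1/δ]` is a standard étale `A`-algebra (SGA1 I 7.6; Stacks 00UE).
[cite: StacksProject, Tag 00UE] -/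
def pair (hQ : Q.Monic) : StandardEtalePair A where
  f := Q
  monic_f := hQ
  g := C (resDeriv Q)
  cond := by
    obtain ⟨p, q, e⟩ := exists_derivative_mul_add_mul_eq Q hQ
    exact ⟨p, q, 1, by rw [pow_one, e]⟩

/-- `f` of the pair is `Q`. [folklore] -/
@[simp] theorem pair_f (hQ : Q.Monic) : (pair Q hQ).f = Q := rfl

/-- `g` of the pair is the constant `δ(Q)`. [folklore] -/
@[simp] theorem pair_g (hQ : Q.Monic) : (pair Q hQ).g = C (resDeriv Q) := rfl

/-- The class of `τ` in `A[τ]/(Q)` is a root of `Q` off the zeros of `C δ`, when `δ` is a unit.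
[folklore] -/
theorem hasMap_root (hQ : Q.Monic) (hu : IsUnit (resDeriv Q)) :
    (pair Q hQ).HasMap (AdjoinRoot.root Q) := by
  refine ⟨?_, ?_⟩
  · rw [pair_f, AdjoinRoot.aeval_eq, AdjoinRoot.mk_self]
  · rw [pair_g, aeval_C]
    exact hu.map _

/-- **`A[τ]/(Q)` is standard étale when `δ(Q)` is a unit**: the presentation of `AdjoinRoot Q` by the
pair `⟨Q, δ⟩` with generator the class of `τ` (the standard étale algebra of the pair already
inverts `δ`, so `A[τ][y]/(Q, yδ - 1) → A[τ]/(Q)`, `τ ↦ τ̄`, `y ↦ δ⁻¹`, is an isomorphism with inverse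
`τ̄ ↦ τ`). [cite: StacksProject, Tag 00UE] [cite: SGA1, Exp. I Thm. 7.6] -/
def presentation (hQ : Q.Monic) (hu : IsUnit (resDeriv Q)) :
    StandardEtalePresentation A (AdjoinRoot Q) where
  P := pair Q hQ
  x := AdjoinRoot.root Q
  hasMap := hasMap_root Q hQ hu
  lift_bijective := by
    set L := (pair Q hQ).lift (AdjoinRoot.root Q) (hasMap_root Q hQ hu) with hL
    have hX : Q.eval₂ (↑(Algebra.ofId A (pair Q hQ).Ring)) (pair Q hQ).X = 0 := by
      have h := (pair Q hQ).hasMap_X.1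
      rwa [pair_f, aeval_def] at h
    let M : AdjoinRoot Q →ₐ[A] (pair Q hQ).Ring :=
      AdjoinRoot.liftAlgHom Q (Algebra.ofId A (pair Q hQ).Ring) (pair Q hQ).X hX
    have hML : M.comp L = AlgHom.id A _ := StandardEtalePair.hom_ext (by
      rw [AlgHom.comp_apply, hL, StandardEtalePair.lift_X, AlgHom.id_apply]
      exact AdjoinRoot.liftAlgHom_root Q _ _ hX)
    have hLM : L.comp M = AlgHom.id A _ := AdjoinRoot.algHom_ext (by
      rw [AlgHom.comp_apply, AlgHom.id_apply, AdjoinRoot.liftAlgHom_root, hL,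
        StandardEtalePair.lift_X])
    exact (AlgEquiv.ofAlgHom L M hLM hML).bijective

/-- `AdjoinRoot Q` is a standard étale `A`-algebra when `δ(Q)` is a unit. [cite: StacksProject, Tag 00UE] -/
theorem isStandardEtale (hQ : Q.Monic) (hu : IsUnit (resDeriv Q)) :
    Algebra.IsStandardEtale A (AdjoinRoot Q) :=
  ⟨⟨presentation Q hQ hu⟩⟩

/-- `AdjoinRoot Q` is an étale `A`-algebra when `δ(Q)` is a unit (Dedekind–Kummer).
[cite: StacksProject, Tag 00UE] -/
theorem etale_adjoinRoot (hQ : Q.Monic) (hu : IsUnit (resDeriv Q)) : Algebra.Etale A (AdjoinRoot Q) := by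
  haveI := isStandardEtale Q hQ hu
  infer_instance

/-- `A[τ]/(Q)` is a finite `A`-module for `Q` monic (power basis `1, τ, …, τ^{d-1}`). [folklore] -/
theorem finite_adjoinRoot (hQ : Q.Monic) : Module.Finite A (AdjoinRoot Q) := by
  nontriviality A
  exact (AdjoinRoot.powerBasis' hQ).finite

/-- Over a field of characteristic `0`, `δ(Q)` is Mathlib's default-degree resultant `Res(Q, Q')`.
[folklore] -/
theorem resDeriv_eq_resultant {K : Type*} [Field K] [CharZero K] (Q : K[X]) :
    resDeriv Q = Q.resultant Q.derivative := by
  unfold resDeriv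
  rw [natDegree_derivative]

/-- **Simple roots ⟺ `δ ≠ 0`** over an algebraically closed field of characteristic `0`: for `Q`
monic, `δ(Q) ≠ 0` iff the roots of `Q` (with multiplicity) have no repetition. [folklore] -/
theorem resDeriv_ne_zero_iff_nodup_roots {K : Type*} [Field K] [CharZero K] [IsAlgClosed K]
    {Q : K[X]} (hQ : Q.Monic) : resDeriv Q ≠ 0 ↔ Q.roots.Nodup := by
  rw [resDeriv_eq_resultant, ← isUnit_iff_ne_zero, isUnit_resultant_iff_isCoprime hQ,
    ← separable_def, nodup_roots_iff_of_splits hQ.ne_zero (IsAlgClosed.splits Q)]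

end Algebra

/-! ### Step 2: the finite étale `X`-scheme `Spec Γ(X, U)[τ]/(Q)` over an affine open `U` -/

section SchemeY

variable {X : SchemeOver ℂ} {U : X.left.Opens} (hU : IsAffineOpen U) (Q : Γ(X.left, U)[X])

/-- `Spec Γ(X, U)[τ]/(Q) ⟶ U`, the structure morphism of the algebra `Γ(X, U) → Γ(X, U)[τ]/(Q)`
followed by `Spec Γ(X, U) ≅ U`. [folklore] -/
def toU : Spec (.of (AdjoinRoot Q)) ⟶ (U : Scheme) :=
  Spec.map (CommRingCat.ofHom (algebraMap Γ(X.left, U) (AdjoinRoot Q))) ≫ hU.isoSpec.inv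

/-- `toU` followed by `U ↪ X` is `Spec` of the algebra map followed by `IsAffineOpen.fromSpec`.
[folklore] -/
theorem toU_ι : toU hU Q ≫ U.ι =
    Spec.map (CommRingCat.ofHom (algebraMap Γ(X.left, U) (AdjoinRoot Q))) ≫ hU.fromSpec := by
  rw [toU, Category.assoc, IsAffineOpen.isoSpec_inv_ι]

/-- **The `X`-scheme `Y = Spec Γ(X, U)[τ]/(Q)`** (over `ℂ` through `X`). [folklore] -/
def Y : SchemeOver ℂ := Over.mk ((toU hU Q ≫ U.ι) ≫ X.hom)

/-- `Y` is affine. [folklore] -/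
instance isAffine_Y_left : IsAffine (Y hU Q).left :=
  inferInstanceAs (IsAffine (Spec (.of (AdjoinRoot Q))))

/-- The structure morphism `g : Y ⟶ X` (over `ℂ`), `g = toU ≫ (U ↪ X)`. [folklore] -/
def g : Y hU Q ⟶ X := Over.homMk (toU hU Q ≫ U.ι) rfl

/-- `g = toU ≫ (U ↪ X)` on schemes. [folklore] -/
@[simp] theorem g_left : (g hU Q).left = toU hU Q ≫ U.ι := rfl

/-- `toU` is finite for `Q` monic (`Γ(X, U)[τ]/(Q)` is a finite `Γ(X, U)`-module). [folklore] -/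
theorem isFinite_toU (hQ : Q.Monic) : IsFinite (toU hU Q) := by
  haveI : IsFinite (Spec.map (CommRingCat.ofHom (algebraMap Γ(X.left, U) (AdjoinRoot Q)))) := by
    rw [IsFinite.SpecMap_iff, CommRingCat.hom_ofHom, RingHom.finite_algebraMap]
    exact finite_adjoinRoot Q hQ
  unfold toU
  infer_instance

/-- **`toU` is étale when `δ(Q)` is a unit of `Γ(X, U)`** (step 1: `Γ(X, U)[τ]/(Q)` is standard
étale). [cite: StacksProject, Tag 00UE] -/
theorem etale_toU (hQ : Q.Monic) (hu : IsUnit (resDeriv Q)) : Etale (toU hU Q) := by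
  haveI : Etale (Spec.map (CommRingCat.ofHom (algebraMap Γ(X.left, U) (AdjoinRoot Q)))) := by
    rw [HasRingHomProperty.Spec_iff (P := @Etale), CommRingCat.hom_ofHom, RingHom.etale_algebraMap]
    exact etale_adjoinRoot Q hQ hu
  unfold toU
  infer_instance

/-- `g` is étale when `δ(Q)` is a unit. [cite: StacksProject, Tag 00UE] -/
theorem etale_g_left (hQ : Q.Monic) (hu : IsUnit (resDeriv Q)) : Etale (g hU Q).left := by
  haveI := etale_toU hU Q hQ hu
  have h : Etale (X := Spec (.of (AdjoinRoot Q))) (toU hU Q ≫ U.ι) := inferInstance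
  exact h

/-- `g⁻¹ U = Y`. [folklore] -/
theorem preimage_U : (g hU Q).left ⁻¹ᵁ U = ⊤ := by
  change toU hU Q ⁻¹ᵁ (U.ι ⁻¹ᵁ U) = ⊤
  rw [Scheme.Opens.ι_preimage_self]
  rfl

/-- `⊤ ≤ g⁻¹ U` (the shape consumed by `Scheme.Hom.appLE`). [folklore] -/
theorem top_le_preimage_U : (⊤ : (Y hU Q).left.Opens) ≤ (g hU Q).left ⁻¹ᵁ U :=
  (preimage_U hU Q).ge

/-- `Γ(Y, ⊤)` as a `Γ(X, U)`-algebra by pull-back along `g` (the convention of the standard-étale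
charts of `RiemannExistenceEtaleLocalHomeomorph.lean`). [folklore] -/
@[reducible] def algebraTop : Algebra Γ(X.left, U) Γ((Y hU Q).left, ⊤) :=
  ((g hU Q).left.appLE U ⊤ (top_le_preimage_U hU Q)).hom.toAlgebra

attribute [local instance] algebraTop

/-- Unfolding `algebraTop`. [folklore] -/
theorem algebraMap_top_eq (r : Γ(X.left, U)) :
    algebraMap Γ(X.left, U) Γ((Y hU Q).left, ⊤) r =
      (g hU Q).left.appLE U ⊤ (top_le_preimage_U hU Q) r := rfl

/-- **Pull-back of sections along `g` is the algebra map `Γ(X, U) → Γ(X, U)[τ]/(Q)`**, read through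
`Γ(Spec B, ⊤) = B` (Mathlib `IsAffineOpen.fromSpec_app_self`, `Scheme.ΓSpecIso_naturality`).
[folklore] -/
theorem ΓSpecIso_hom_appLE (r : Γ(X.left, U)) :
    (Scheme.ΓSpecIso (.of (AdjoinRoot Q))).hom
        ((g hU Q).left.appLE U ⊤ (top_le_preimage_U hU Q) r) =
      algebraMap Γ(X.left, U) (AdjoinRoot Q) r := by
  have key : ∀ (f : Spec (.of (AdjoinRoot Q)) ⟶ X.left)
      (_ : f = Spec.map (CommRingCat.ofHom (algebraMap Γ(X.left, U) (AdjoinRoot Q))) ≫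
        hU.fromSpec) (e' : (⊤ : (Spec (.of (AdjoinRoot Q))).Opens) ≤ f ⁻¹ᵁ U),
      (Scheme.ΓSpecIso (.of (AdjoinRoot Q))).hom (f.appLE U ⊤ e' r) =
        algebraMap Γ(X.left, U) (AdjoinRoot Q) r := by
    rintro _ rfl e'
    rw [Scheme.Hom.comp_appLE, hU.fromSpec_app_self]
    simp only [Category.assoc, Scheme.Hom.map_appLE]
    rw [CommRingCat.comp_apply, ΓSpecIso_hom_SpecMap_appLE_top]
    exact congrArg (algebraMap Γ(X.left, U) (AdjoinRoot Q)) (Iso.inv_hom_id_apply _ r)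
  exact key _ (by rw [g_left, toU_ι]) _

/-- **`Γ(X, U)[τ]/(Q) ≅ Γ(Y, ⊤)` as `Γ(X, U)`-algebras** (`Scheme.ΓSpecIso`, with `ΓSpecIso_hom_appLE`
for the compatibility with the two algebra structures). [folklore] -/
def sectionsEquiv : AdjoinRoot Q ≃ₐ[Γ(X.left, U)] Γ((Y hU Q).left, ⊤) :=
  { (Scheme.ΓSpecIso (.of (AdjoinRoot Q))).commRingCatIsoToRingEquiv.symm with
    commutes' := fun r ↦ by
      apply (Scheme.ΓSpecIso (.of (AdjoinRoot Q))).commRingCatIsoToRingEquiv.injective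
      change (Scheme.ΓSpecIso (.of (AdjoinRoot Q))).commRingCatIsoToRingEquiv
          ((Scheme.ΓSpecIso (.of (AdjoinRoot Q))).commRingCatIsoToRingEquiv.symm _) = _
      rw [RingEquiv.apply_symm_apply, algebraMap_top_eq]
      exact (ΓSpecIso_hom_appLE hU Q r).symm }

/-- `sectionsEquiv` is `(ΓSpecIso _).inv`. [folklore] -/
theorem sectionsEquiv_apply (b : AdjoinRoot Q) :
    sectionsEquiv hU Q b = (Scheme.ΓSpecIso (.of (AdjoinRoot Q))).inv b := rfl

/-- The coordinate `τ̄ ∈ Γ(Y, ⊤)`: the class of `τ` read on `Y`. [folklore] -/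
def xcoord : Γ((Y hU Q).left, ⊤) := sectionsEquiv hU Q (AdjoinRoot.root Q)

/-- **The standard-étale presentation of `Γ(Y, ⊤)` over `Γ(X, U)`** by the pair `⟨Q, δ(Q)⟩` with
generator `τ̄`, when `δ(Q)` is a unit. [cite: StacksProject, Tag 00UE] [cite: SGA1, Exp. I Thm. 7.6] -/
def Pr (hQ : Q.Monic) (hu : IsUnit (resDeriv Q)) :
    StandardEtalePresentation Γ(X.left, U) Γ((Y hU Q).left, ⊤) :=
  (presentation Q hQ hu).mapEquiv (sectionsEquiv hU Q)

/-- `f` of the presentation is `Q`. [folklore] -/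
@[simp] theorem Pr_f (hQ : Q.Monic) (hu : IsUnit (resDeriv Q)) : (Pr hU Q hQ hu).f = Q := rfl

/-- `g` of the presentation is `C δ(Q)`. [folklore] -/
@[simp] theorem Pr_g (hQ : Q.Monic) (hu : IsUnit (resDeriv Q)) :
    (Pr hU Q hQ hu).g = C (resDeriv Q) := rfl

/-- The generator of the presentation is `τ̄`. [folklore] -/
@[simp] theorem Pr_x (hQ : Q.Monic) (hu : IsUnit (resDeriv Q)) :
    (Pr hU Q hQ hu).x = xcoord hU Q := rfl

/-- The chart convention `algebraMap = g^*` holds by definition. [folklore] -/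
theorem halg : ∀ r, algebraMap Γ(X.left, U) Γ((Y hU Q).left, ⊤) r =
    (g hU Q).left.appLE U ⊤ (top_le_preimage_U hU Q) r := fun _ ↦ rfl

/-! ### Complex points of `Y`: over `P ∈ U(ℂ)` they are the simple roots of `Q(P)` -/

/-- Complex points of `Y` lie over `U`. [folklore] -/
theorem pt_map_g_mem (z : ComplexPoints (Y hU Q)) : (AlgPoints.map (g hU Q) z).pt ∈ U :=
  top_le_preimage_U hU Q (show z.pt ∈ (⊤ : (Y hU Q).left.Opens) from trivial)

/-- The `τ̄`-coordinate `τ̄(z) ∈ ℂ` of a complex point `z` of `Y`. [folklore] -/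
def xval (z : ComplexPoints (Y hU Q)) : ℂ := z.eval ⊤ trivial (xcoord hU Q)

/-- **`τ̄(z)` is a root of `Q(g(z))`.** [cite: SGA1, Exp. XII Prop. 3.1 (iii)] -/
theorem eval_map_Q_xval (hQ : Q.Monic) (hu : IsUnit (resDeriv Q)) (z : ComplexPoints (Y hU Q)) :
    (Q.map ((AlgPoints.map (g hU Q) z).evalRingHom U (pt_map_g_mem hU Q z))).eval (xval hU Q z)
      = 0 := by
  have h := eval_map_f_eq_zero (g hU Q) (top_le_preimage_U hU Q) (halg hU Q) (Pr hU Q hQ hu)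
    (P := z) trivial
  rwa [Pr_f, Pr_x] at h

/-- **Complex points of `Y` are determined by `(g(z), τ̄(z))`.** [cite: SGA1, Exp. XII Prop. 3.1 (iii)] -/
theorem ext_of_xval_eq (hQ : Q.Monic) (hu : IsUnit (resDeriv Q)) {z z' : ComplexPoints (Y hU Q)}
    (hmap : AlgPoints.map (g hU Q) z = AlgPoints.map (g hU Q) z')
    (hx : xval hU Q z = xval hU Q z') : z = z' :=
  eq_of_map_eq_of_eval_x_eq (g hU Q) (top_le_preimage_U hU Q) (halg hU Q) (Pr hU Q hQ hu)
    (isAffineOpen_top (Y hU Q).left) trivial trivial hmap (by rwa [Pr_x])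

/-- **Continuous sections of `g(ℂ)` from continuous roots of `Q`** (universal property of the
standard étale algebra with values in `C(S, ℂ)`): a continuous family `ι : S → U(ℂ)` with a
continuous choice `xS` of a root of `Q(ι s)` lifts to a continuous `σ : S → Y(ℂ)` with
`g ∘ σ = ι` and `τ̄ ∘ σ = xS`. [cite: SGA1, Exp. XII Prop. 3.1 (iii)] -/
theorem exists_continuous_section_Y (hQ : Q.Monic) (hu : IsUnit (resDeriv Q))
    {S : Type} [TopologicalSpace S] (ι : S → ComplexPoints X) (hι : Continuous ι)
    (hιU : ∀ s, (ι s).pt ∈ U) (xS : C(S, ℂ))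
    (hx : ∀ s, (Q.map ((ι s).evalRingHom U (hιU s))).eval (xS s) = 0) :
    ∃ σ : S → ComplexPoints (Y hU Q), Continuous σ ∧
      (∀ s, AlgPoints.map (g hU Q) (σ s) = ι s) ∧ ∀ s, xval hU Q (σ s) = xS s := by
  obtain ⟨σ, hσc, hσW, hσmap, hσx⟩ := exists_continuous_section (g hU Q) (top_le_preimage_U hU Q)
    (halg hU Q) (Pr hU Q hQ hu) hU (isAffineOpen_top (Y hU Q).left) ι hι hιU xS
    (fun s ↦ by rw [Pr_f]; exact hx s)
    (fun s ↦ by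
      rw [Pr_g, Polynomial.map_C, eval_C, evalRingHom_apply]
      exact ((hu.map ((ι s).evalRingHom U (hιU s))).ne_zero))
  exact ⟨σ, hσc, hσmap, fun s ↦ by rw [← hσx s, Pr_x]; rfl⟩

end SchemeY

/-! ### Step 3: the algebraisation of `q` over `U` -/

section Local

variable {X : SchemeOver ℂ} {U : X.left.Opens} (hU : IsAffineOpen U) (Q : Γ(X.left, U)[X])
  (hQ : Q.Monic) (hu : IsUnit (resDeriv Q))
  {T : Type} [TopologicalSpace T] (q : T → ComplexPoints X) (hfin : ∀ P, (q ⁻¹' {P}).Finite)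
  (h : T → ℂ)
  (hroots : ∀ (P : ComplexPoints X) (hP : P.pt ∈ U),
    (Q.map (P.evalRingHom U hP)).roots = ((hfin P).toFinset.val).map h)

attribute [local instance] algebraTop

omit [TopologicalSpace T] in
include hQ hu hroots in
/-- **`h` separates every fibre of `q` over `U`**: the roots of `Q(P)` are simple because
`δ(Q)(P) ≠ 0` (`δ(Q)` is a unit of `Γ(X, U)`), and they are the values of `h` on `q⁻¹(P)`.
[folklore] -/
theorem injOn_fibre (P : ComplexPoints X) (hP : P.pt ∈ U) : Set.InjOn h (q ⁻¹' {P}) := by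
  have hnodup : (((hfin P).toFinset.val).map h).Nodup := by
    rw [← hroots P hP, ← resDeriv_ne_zero_iff_nodup_roots (hQ.map _), resDeriv_map Q _ hQ]
    exact (hu.map _).ne_zero
  intro t ht t' ht' htt'
  exact Multiset.inj_on_of_nodup_map hnodup t (Finset.mem_val.mpr ((hfin P).mem_toFinset.mpr ht))
    t' (Finset.mem_val.mpr ((hfin P).mem_toFinset.mpr ht')) htt'

omit [TopologicalSpace T] in
include hQ hroots in
/-- `h t` is a root of `Q(q t)`. [folklore] -/
theorem eval_map_Q_h (t : T) (ht : (q t).pt ∈ U) :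
    (Q.map ((q t).evalRingHom U ht)).eval (h t) = 0 := by
  have hmem : h t ∈ (Q.map ((q t).evalRingHom U ht)).roots := by
    rw [hroots (q t) ht]
    exact Multiset.mem_map_of_mem _ (Finset.mem_val.mpr ((hfin _).mem_toFinset.mpr rfl))
  exact (mem_roots (hQ.map _).ne_zero).mp hmem

include hQ hu hroots in
/-- **The section `t ↦ (q t, h t)` of `Y(ℂ) → U(ℂ)` over `q⁻¹(U(ℂ))`**: continuous, with
`g(σ t) = q t` and `τ̄(σ t) = h t`, for `h` continuous on `q⁻¹(U(ℂ))`.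
[cite: SGA1, Exp. XII Prop. 3.1 (iii)] -/
theorem exists_section (hq : Continuous q) (hcont : ContinuousOn h (q ⁻¹' {P | P.pt ∈ U})) :
    ∃ σ : ↥(q ⁻¹' {P : ComplexPoints X | P.pt ∈ U}) → ComplexPoints (Y hU Q),
      Continuous σ ∧ (∀ t, AlgPoints.map (g hU Q) (σ t) = q t) ∧ ∀ t, xval hU Q (σ t) = h t :=
  exists_continuous_section_Y hU Q hQ hu (S := ↥(q ⁻¹' {P : ComplexPoints X | P.pt ∈ U}))
    (fun t ↦ q t) (hq.comp continuous_subtype_val)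
    (fun t ↦ t.2) ⟨(q ⁻¹' {P : ComplexPoints X | P.pt ∈ U}).restrict h, hcont.restrict⟩
    fun t ↦ eval_map_Q_h Q hQ q hfin h hroots t.1 t.2

omit [TopologicalSpace T] in
include hQ hu hroots in
/-- The section is injective (`h` separates the fibres over `U`). [folklore] -/
theorem section_injective {σ : ↥(q ⁻¹' {P : ComplexPoints X | P.pt ∈ U}) → ComplexPoints (Y hU Q)}
    (hσmap : ∀ t, AlgPoints.map (g hU Q) (σ t) = q t) (hσx : ∀ t, xval hU Q (σ t) = h t) :
    Function.Injective σ := by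
  intro t t' htt'
  have hq' : q t = q t' := by rw [← hσmap t, ← hσmap t', htt']
  have hh : h t = h t' := by rw [← hσx t, ← hσx t', htt']
  exact Subtype.ext (injOn_fibre Q hQ hu q hfin h hroots (q t) t.2 rfl hq'.symm hh)

omit [TopologicalSpace T] in
include hQ hu hroots in
/-- The section is onto: a complex point `z` of `Y` over `P ∈ U(ℂ)` has `τ̄(z)` a root of `Q(P)`,
i.e. `τ̄(z) = h t` for some `t ∈ q⁻¹(P)`, and then `z = σ t` (points of `Y` are determined by
`(g(z), τ̄(z))`). [cite: SGA1, Exp. XII Prop. 3.1 (iii)] -/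
theorem section_surjective {σ : ↥(q ⁻¹' {P : ComplexPoints X | P.pt ∈ U}) → ComplexPoints (Y hU Q)}
    (hσmap : ∀ t, AlgPoints.map (g hU Q) (σ t) = q t) (hσx : ∀ t, xval hU Q (σ t) = h t) :
    Function.Surjective σ := by
  intro z
  have hP : (AlgPoints.map (g hU Q) z).pt ∈ U := pt_map_g_mem hU Q z
  have hroot : xval hU Q z ∈ (Q.map ((AlgPoints.map (g hU Q) z).evalRingHom U hP)).roots :=
    (mem_roots (hQ.map _).ne_zero).mpr (eval_map_Q_xval hU Q hQ hu z)
  rw [hroots _ hP, Multiset.mem_map] at hroot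
  obtain ⟨t, ht, hht⟩ := hroot
  have hqt : q t = AlgPoints.map (g hU Q) z := (hfin _).mem_toFinset.mp (Finset.mem_val.mp ht)
  refine ⟨⟨t, show (q t).pt ∈ U by rw [hqt]; exact hP⟩, ext_of_xval_eq hU Q hQ hu ?_ ?_⟩
  · rw [hσmap]
    exact hqt
  · rw [hσx]
    exact hht

include hQ hu hroots in
/-- **`Y(ℂ) ≃ₜ q⁻¹(U(ℂ))` over `X(ℂ)`**: the section is a continuous bijection between spaces étalé
over `X(ℂ)` (`q` a local homeomorphism; `g(ℂ)` a local homeomorphism since `g` is étale,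
`isLocalHomeomorph_map_of_etale`), hence a local homeomorphism (`IsLocalHomeomorph.of_comp`),
hence a homeomorphism. [cite: SGA1, Exp. XII Prop. 3.1 (iii) and Thm. 5.1] -/
theorem exists_homeomorph (hq : IsLocalHomeomorph q) (hcont : ContinuousOn h (q ⁻¹' {P | P.pt ∈ U})) :
    ∃ Φ : ComplexPoints (Y hU Q) ≃ₜ ↥(q ⁻¹' {P : ComplexPoints X | P.pt ∈ U}),
      ∀ z, q (Φ z) = AlgPoints.map (g hU Q) z := by
  obtain ⟨σ, hσc, hσmap, hσx⟩ := exists_section hU Q hQ hu q hfin h hroots hq.continuous hcont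
  have hbij : Function.Bijective σ :=
    ⟨section_injective hU Q hQ hu q hfin h hroots hσmap hσx,
      section_surjective hU Q hQ hu q hfin h hroots hσmap hσx⟩
  have hcomp : IsLocalHomeomorph (AlgPoints.map (g hU Q) ∘ σ) := by
    have heq : AlgPoints.map (g hU Q) ∘ σ = q ∘ Subtype.val := funext fun t ↦ hσmap t
    rw [heq]
    exact hq.comp ((AlgPoints.isOpen_setOf_pt_mem U).preimage hq.continuous
      |>.isOpenEmbedding_subtypeVal).isLocalHomeomorph
  haveI := etale_g_left hU Q hQ hu
  have hσl : IsLocalHomeomorph σ :=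
    IsLocalHomeomorph.of_comp hcomp (isLocalHomeomorph_map_of_etale (g hU Q)) hσc
  refine ⟨(hσl.toHomeomorphOfBijective hbij).symm, fun z ↦ ?_⟩
  obtain ⟨t, rfl⟩ := hbij.2 z
  change q ((hσl.toHomeomorphOfBijective hbij).symm ((hσl.toHomeomorphOfBijective hbij) t)) = _
  rw [Homeomorph.symm_apply_apply, hσmap]

/-- **The algebraisation of `q` over `U`** (`ZariskiLocal.LocalAlgebraization`): `Y = Spec Γ(X, U)[τ]/(Q)`,
finite étale over `U`, with `Y(ℂ) ≃ₜ q⁻¹(U(ℂ))` over `X(ℂ)` — for `Q` monic with `δ(Q)` a unit whose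
roots over every `P ∈ U(ℂ)` are the values of the continuous `h` on `q⁻¹(P)`.
[cite: SGA1, Exp. XII Thm. 5.1 (proof, part 2)] -/
def localAlgebraization (hq : IsLocalHomeomorph q) (hcont : ContinuousOn h (q ⁻¹' {P | P.pt ∈ U})) :
    ZariskiLocal.LocalAlgebraization q U where
  Y := Y hU Q
  g := g hU Q
  h := toU hU Q
  fac := rfl
  isFinite := isFinite_toU hU Q hQ
  etale := etale_toU hU Q hQ hu
  Φ := (exists_homeomorph hU Q hQ hu q hfin h hroots hq hcont).choose
  compat := (exists_homeomorph hU Q hQ hu q hfin h hroots hq hcont).choose_spec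

end Local

/-! ### Step 4: the theorem -/

section Main

variable {X : SchemeOver ℂ} [IsSeparated X.hom] [LocallyOfFiniteType X.hom]
  {T : Type} [TopologicalSpace T]

/-- **Riemann existence, algebraisation step: a finite covering whose sheets are separated by
functions with regular characteristic polynomials is finite étale algebraic.** Let `X` be separated
and locally of finite type over `ℂ` and `q : T → X(ℂ)` a local homeomorphism with finite fibres.
Suppose every complex point `P₀` of `X` has an affine open neighbourhood `U`, a function
`h : T → ℂ` continuous on `q⁻¹(U(ℂ))` and a monic `Q ∈ Γ(X, U)[τ]` such that for all `P ∈ U(ℂ)`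
the roots of `Q(P)` counted with multiplicity are the values of `h` on the fibre `q⁻¹(P)`
(i.e. `Q(P)` is the characteristic polynomial of `h` on the fibre), and `h` is injective on
`q⁻¹(P₀)`. Then `T ≅ Y(ℂ)` over `X(ℂ)` for a finite étale `g : Y ⟶ X`. Proof: steps 1–3 over the
affine opens `D(δ(Q)) ∋ P₀` (`h` injective on `q⁻¹(P₀)` ⟺ `δ(Q)(P₀) ≠ 0`), which cover the closed
points and hence `X` (`ComplexPoints.exists_pt_mem`), glued by
`ZariskiLocal.exists_finite_etale_homeomorph_of_locally`.
[cite: SGA1, Exp. XII Thm. 5.1 (p. 333; proof, part 2)] [cite: StacksProject, Tag 00UE] -/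
theorem exists_finite_etale_homeomorph_of_charPoly (q : T → ComplexPoints X)
    (hq : IsLocalHomeomorph q) (hfin : ∀ P, (q ⁻¹' {P}).Finite)
    (H : ∀ P₀ : ComplexPoints X, ∃ (U : X.left.Opens) (_ : IsAffineOpen U) (_ : P₀.pt ∈ U)
      (h : T → ℂ) (Q : Γ(X.left, U)[X]), ContinuousOn h (q ⁻¹' {P | P.pt ∈ U}) ∧ Q.Monic ∧
      (∀ (P : ComplexPoints X) (hP : P.pt ∈ U),
        (Q.map (P.evalRingHom U hP)).roots = ((hfin P).toFinset.val).map h) ∧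
      Set.InjOn h (q ⁻¹' {P₀})) :
    ∃ (Y : SchemeOver ℂ) (g : Y ⟶ X) (Φ : ComplexPoints Y ≃ₜ T),
      IsFinite g.left ∧ Etale g.left ∧ ∀ z, q (Φ z) = AlgPoints.map g z := by
  choose U hU hP₀ h Q hcont hQ hroots hinj using H
  -- `δ(Q)(P₀) ≠ 0`: the roots of `Q(P₀)` are the `h t`, `t ∈ q⁻¹(P₀)`, pairwise distinct
  have hδ : ∀ P₀ : ComplexPoints X, (P₀.evalRingHom (U P₀) (hP₀ P₀)) (resDeriv (Q P₀)) ≠ 0 := by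
    intro P₀
    rw [← resDeriv_map _ _ (hQ P₀), resDeriv_ne_zero_iff_nodup_roots ((hQ P₀).map _),
      hroots P₀ P₀ (hP₀ P₀)]
    exact Multiset.Nodup.map_on (fun t ht t' ht' e ↦ hinj P₀
      ((hfin P₀).mem_toFinset.mp (Finset.mem_val.mp ht))
      ((hfin P₀).mem_toFinset.mp (Finset.mem_val.mp ht')) e) (Finset.nodup _)
  -- the affine opens `U' P₀ = D(δ) ⊆ U P₀`
  let U' : ComplexPoints X → X.left.Opens := fun P₀ ↦ X.left.basicOpen (resDeriv (Q P₀))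
  have hle : ∀ P₀, U' P₀ ≤ U P₀ := fun P₀ ↦ X.left.basicOpen_le _
  have hmem' : ∀ P₀ : ComplexPoints X, P₀.pt ∈ U' P₀ := fun P₀ ↦
    (eval_ne_zero_iff_mem_basicOpen P₀ (U P₀) (hP₀ P₀) _).mp (hδ P₀)
  -- the local algebraisations over the `U' P₀`
  have hD : ∀ P₀, Nonempty (ZariskiLocal.LocalAlgebraization q (U' P₀)) := by
    intro P₀
    haveI := (hU P₀).isLocalization_basicOpen (resDeriv (Q P₀))
    have hQ' : ((Q P₀).map (algebraMap Γ(X.left, U P₀) Γ(X.left, U' P₀))).Monic := (hQ P₀).map _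
    have hu' : IsUnit (resDeriv ((Q P₀).map (algebraMap Γ(X.left, U P₀) Γ(X.left, U' P₀)))) := by
      rw [resDeriv_map _ _ (hQ P₀)]
      exact IsLocalization.Away.algebraMap_isUnit (resDeriv (Q P₀))
    have hcont' : ContinuousOn (h P₀) (q ⁻¹' {P | P.pt ∈ U' P₀}) :=
      (hcont P₀).mono (Set.preimage_mono fun P hP ↦ hle P₀ hP)
    have hroots' : ∀ (P : ComplexPoints X) (hP : P.pt ∈ U' P₀),
        (((Q P₀).map (algebraMap Γ(X.left, U P₀) Γ(X.left, U' P₀))).map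
          (P.evalRingHom (U' P₀) hP)).roots = ((hfin P).toFinset.val).map (h P₀) := by
      intro P hP
      rw [Polynomial.map_map]
      have hc : (P.evalRingHom (U' P₀) hP).comp (algebraMap Γ(X.left, U P₀) Γ(X.left, U' P₀)) =
          P.evalRingHom (U P₀) (hle P₀ hP) :=
        RingHom.ext fun a ↦ by
          rw [RingHom.comp_apply, evalRingHom_apply, evalRingHom_apply, eval_algebraMap_basicOpen]
      rw [hc]
      exact hroots P₀ P (hle P₀ hP)
    exact ⟨localAlgebraization ((hU P₀).basicOpen _) _ hQ' hu' q hfin (h P₀) hroots' hq hcont'⟩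
  -- the `U' P₀` cover `X`: they cover the closed points
  have hcov : (⨆ P₀, U' P₀ : X.left.Opens) = ⊤ := by
    by_contra hne
    have hne' : ((⨆ P₀, U' P₀ : X.left.Opens) : Set X.left) ≠ Set.univ := fun e ↦
      hne (TopologicalSpace.Opens.coe_eq_univ.mp e)
    obtain ⟨P, hP⟩ := ComplexPoints.exists_pt_mem (Set.nonempty_compl.mpr hne')
      (TopologicalSpace.Opens.isOpen _).isClosed_compl.isLocallyClosed
    exact hP (TopologicalSpace.Opens.mem_iSup.mpr ⟨P, hmem' P⟩)
  refine ZariskiLocal.exists_finite_etale_homeomorph_of_locally q hq.continuous fun x ↦ ?_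
  have hx : x ∈ (⨆ P₀, U' P₀ : X.left.Opens) := by rw [hcov]; trivial
  obtain ⟨P₀, hP⟩ := TopologicalSpace.Opens.mem_iSup.mp hx
  exact ⟨U' P₀, hP, hD P₀⟩

/-- The same for a covering map `q` with finite fibres (the shape of the Riemann-existence
statements of the tree). [cite: SGA1, Exp. XII Thm. 5.1 (p. 333)] -/
theorem exists_finite_etale_homeomorph_of_charPoly_of_isCoveringMap (q : T → ComplexPoints X)
    (hq : IsCoveringMap q) (hfin : ∀ P, (q ⁻¹' {P}).Finite)
    (H : ∀ P₀ : ComplexPoints X, ∃ (U : X.left.Opens) (_ : IsAffineOpen U) (_ : P₀.pt ∈ U)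
      (h : T → ℂ) (Q : Γ(X.left, U)[X]), ContinuousOn h (q ⁻¹' {P | P.pt ∈ U}) ∧ Q.Monic ∧
      (∀ (P : ComplexPoints X) (hP : P.pt ∈ U),
        (Q.map (P.evalRingHom U hP)).roots = ((hfin P).toFinset.val).map h) ∧
      Set.InjOn h (q ⁻¹' {P₀})) :
    ∃ (Y : SchemeOver ℂ) (g : Y ⟶ X) (Φ : ComplexPoints Y ≃ₜ T),
      IsFinite g.left ∧ Etale g.left ∧ ∀ z, q (Φ z) = AlgPoints.map g z :=
  exists_finite_etale_homeomorph_of_charPoly q hq.isLocalHomeomorph hfin H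

end Main

end CharPoly

end Literature.AlgebraicGeometry.FundamentalGroup

end
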